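import Summits.CriticalPhenomena.PercolationContinuityZ3.Theorems.PercNearOneGluingNoHeavyLowerTailSahiCombMasterFamily
import Summits.CriticalPhenomena.PercolationContinuityZ3.Theorems.PercNearOneGluingNoHeavyLowerTailThreePartitionADTwisted
import Summits.CriticalPhenomena.PercolationContinuityZ3.Theorems.SahiMasterFamilyEqPrincipal

/-!
# `NoHeavyLowerTail` (crux stmt-CriticalPhenomena-4575), route P3 (Ahlswede–Daykin): the BRIDGE between the three-partition
# form (★★) and the comb (tensor-Bernstein) hierarchy — `ThreePartitionPositivityTwisted → MasterFamilyCombPos 3`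

Support file (cell `prim-l12`, seat P3, gen 2; `--supports stmt-CriticalPhenomena-4575`).  Nothing is asserted about the crux and no
conjecture is assumed except as an explicit hypothesis; no `sorry`, standard axioms.

The two typed forms of "coefficientwise Sahi `C₃` on product cubes" in the tree were so far linked only by a machine check
(`…ThreePartitionAD`, header: "the formal bridge `N ↔ fibsum richardsKernel` is not in this file"; `…TwoPartitionKleitman`, header,
likewise for `k = 2`):
* `ThreePartition.ThreePartitionPositivityTwisted` (★★) (`…ThreePartitionADTwisted`, this seat): for every finite ground set, every twist
  `τ` and all up-sets `𝒰,𝒱,𝒲`, the twisted three-partition functional `threePartNT τ 𝒰 𝒱 𝒲 = 2·topT + teeT − Σ deeT` is `≥ 0`;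
* `MasterFamilyCombPos 3` (M⁺-3) (`…SahiCombMasterFamily`, cell prim-masterthm): `p ↦ E₃(μ_p; 1_U,1_V,1_W)` is a nonnegative
  combination of the degree-3 tensor-Bernstein basis `∏_e p_e^{j_e}(1−p_e)^{3−j_e}` on every finite cube.

This file PROVES `(★★) ⟹ (M⁺-3)` (`masterFamilyCombPos_three_of_threePartitionPositivityTwisted`), hence `(★★) ⟹` Sahi's `C₃` on
all product measures (`masterFamilyNonneg_three_of_threePartitionPositivityTwisted`; `MasterFamilyNonneg 3` is Kahn's Conjecture 5 by
`masterFamilyNonneg_three_iff_kahnConjecture`), through two exact identities: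
1. **Expansion** (`sahiE_three_ind_bernstein`): `E₃(μ_p; 1_U,1_V,1_W) = Σ_{j ≤ 3} combCoef3(j) · ∏_e p_e^{j_e}(1−p_e)^{3−j_e}`, where
   `combCoef3 U V W j` is the sum over the THREE-COPY FIBRE `{(ω₁,ω₂,ω₃) : #{c : e ∈ ω_c} = j_e ∀e}` of the kernel
   `2[ω₃∈UVW] + [ω₁∈U][ω₂∈V][ω₃∈W] − [ω₁∈U][ω₃∈VW] − [ω₁∈V][ω₃∈UW] − [ω₁∈W][ω₃∈UV]` (write each of the five terms of `E₃` as an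
   expectation over three independent copies, `sahiE_three_ind_eq_sum_kernel3`; the weight of a triple is the basis function of its
   profile, `weight3_eq_bern`; regroup by profile).
2. **Identification** (`combCoef3_eq_threePartNT`): for `j ≤ 3`, `combCoef3 U V W j = threePartNT (twist j) (secFam j U) (secFam j V) (secFam j W)`
   on the ground set `Act j = {e : j_e ∈ {1,2}}` of ACTIVE coordinates, with twist `{j_e = 2}` and the `j`-SECTIONS `secFam j U =
   {T ⊆ Act j : T ∪ {j_e = 3} ∈ U}` (up-sets if `U` is): the fibre of `j` is parametrised bijectively by the ordered 3-partitions
   `(S₁,S₂,S₃)` of `Act j` via "copy `c` = lift of `S_c ∆ twist`" (`toTriple`/`toPair`, `combCoef3_eq_sum_pairs`), and under this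
   parametrisation the kernel is the integrand of `threePartNT` (`triT_eq_sum_ite`).
So the (★★)-census of this seat (exhaustive `m ≤ 4`, `12 871 040` pairs; ttrl2 `rcomb` `k ≤ 5`) and prim-masterthm's (M⁺-3) census count the
same integers, and every counting theorem about `threePartNT` (e.g. the merge chain `teeT ≤ deeT ≤ topT` of `…ThreePartitionADTwisted`)
is a statement about the tensor-Bernstein coefficients of `E₃`.  The converse `(M⁺-3) ⟹ (★★)` needs uniqueness of tensor-Bernstein
coefficients (`CombPos` only asks for SOME nonnegative representation) and is not in this file.
-/

noncomputable section

open scoped Classical symmDiff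
open Finset

namespace Summit.CriticalPhenomena.PercolationContinuityZ3.Theorems.ThreePartition

open Literature.Combinatorics.Sahi2008
open Literature.Probability.Percolation.DecisionTree (ind ind_of_mem ind_of_not_mem ind_nonneg)
open Literature.Probability.Percolation.BHK2006 (weight)
open SahiComb

variable {ι : Type} [Fintype ι]

/-! ## Three copies: the kernel of `E₃`, profiles, and the tensor-Bernstein coefficients -/

/-- The (non-symmetrised) three-copy kernel of `E₃(1_U,1_V,1_W)` on a triple of configurations `(ω₁,ω₂,ω₃)`:
`2[ω₃ ∈ UVW] + [ω₁ ∈ U][ω₂ ∈ V][ω₃ ∈ W] − [ω₁ ∈ U][ω₃ ∈ VW] − [ω₁ ∈ V][ω₃ ∈ UW] − [ω₁ ∈ W][ω₃ ∈ UV]`. [this work] -/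
def kernel3 (U V W : Set (Set ι)) (ω : Set ι × Set ι × Set ι) : ℝ :=
  2 * ind (U ∩ V ∩ W) ω.2.2 + ind U ω.1 * ind V ω.2.1 * ind W ω.2.2
    - (ind U ω.1 * ind (V ∩ W) ω.2.2 + ind V ω.1 * ind (U ∩ W) ω.2.2 + ind W ω.1 * ind (U ∩ V) ω.2.2)

/-- The profile of a triple of configurations: `e ↦ #{c : e ∈ ω_c} ∈ {0,1,2,3}`. [this work] -/
def prof3 (ω : Set ι × Set ι × Set ι) (e : ι) : ℕ :=
  (if e ∈ ω.1 then 1 else 0) + (if e ∈ ω.2.1 then 1 else 0) + (if e ∈ ω.2.2 then 1 else 0)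

/-- The degree-3 tensor-Bernstein coefficient of `p ↦ E₃(μ_p; 1_U,1_V,1_W)` at the profile `j`: the sum of the kernel
over the three-copy fibre `{(ω₁,ω₂,ω₃) : prof3 = j}`. [this work] -/
def combCoef3 (U V W : Set (Set ι)) (j : ι → ℕ) : ℝ :=
  ∑ ω ∈ (univ : Finset (Set ι × Set ι × Set ι)) with prof3 ω = j, kernel3 U V W ω

/-- A product of three expectations is a sum over triples of configurations. [folklore] -/
theorem ex_mul_ex_mul_ex (μ a b c : Set ι → ℝ) :
    ex μ a * ex μ b * ex μ c =
      ∑ ω : Set ι × Set ι × Set ι, μ ω.1 * μ ω.2.1 * μ ω.2.2 * (a ω.1 * b ω.2.1 * c ω.2.2) := by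
  rw [ex_def, ex_def, ex_def, sum_mul_sum, sum_mul]
  simp only [Fintype.sum_prod_type]
  refine sum_congr rfl fun x _ => ?_
  rw [sum_mul]
  refine sum_congr rfl fun y _ => ?_
  rw [mul_sum]
  exact sum_congr rfl fun z _ => by ring

/-- The product of the three weights of a triple is the degree-3 basis function of its profile. [this work] -/
theorem weight3_eq_bern (p : ι → unitInterval) (ω : Set ι × Set ι × Set ι) :
    bernoulliWeight p ω.1 * bernoulliWeight p ω.2.1 * bernoulliWeight p ω.2.2 = bern (fun _ => 3) (prof3 ω) p := by
  unfold bern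
  simp only [bernoulliWeight, weight]
  rw [← prod_mul_distrib, ← prod_mul_distrib]
  refine prod_congr rfl fun e _ => ?_
  simp only [prof3]
  by_cases h1 : e ∈ ω.1 <;> by_cases h2 : e ∈ ω.2.1 <;> by_cases h3 : e ∈ ω.2.2 <;>
    simp only [h1, h2, h3, if_true, if_false, Nat.reduceAdd, Nat.reduceSub, pow_zero, pow_one, mul_one,
      one_mul] <;> ring

/-- Profiles lie in the box `j ≤ 3`. [this work] -/
theorem prof3_mem_box (ω : Set ι × Set ι × Set ι) : prof3 ω ∈ box (fun _ : ι => 3) := by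
  rw [mem_box]; intro e
  simp only [prof3]
  split_ifs <;> omega

/-- **`E₃` as a three-copy expectation of the kernel.** [this work] -/
theorem sahiE_three_ind_eq_sum_kernel3 (p : ι → unitInterval) (U V W : Set (Set ι)) :
    sahiE (bernoulliWeight p) 3 ![ind U, ind V, ind W] =
      ∑ ω : Set ι × Set ι × Set ι,
        bernoulliWeight p ω.1 * bernoulliWeight p ω.2.1 * bernoulliWeight p ω.2.2 * kernel3 U V W ω := by
  set μ := bernoulliWeight p with hμ
  have h1 : ex μ 1 = 1 := ex_one (sum_bernoulliWeight p)
  rw [sahiE_three]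
  simp only [ind_mul_ind_eq_inter]
  have hT : ex μ (ind (U ∩ V ∩ W)) = ∑ ω : Set ι × Set ι × Set ι,
      μ ω.1 * μ ω.2.1 * μ ω.2.2 * ind (U ∩ V ∩ W) ω.2.2 := by
    rw [show ex μ (ind (U ∩ V ∩ W)) = ex μ 1 * ex μ 1 * ex μ (ind (U ∩ V ∩ W)) by rw [h1, one_mul, one_mul],
      ex_mul_ex_mul_ex]
    exact sum_congr rfl fun ω _ => by simp
  have hD : ∀ A B : Set (Set ι), ex μ (ind A) * ex μ (ind B) = ∑ ω : Set ι × Set ι × Set ι,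
      μ ω.1 * μ ω.2.1 * μ ω.2.2 * (ind A ω.1 * ind B ω.2.2) := by
    intro A B
    rw [show ex μ (ind A) * ex μ (ind B) = ex μ (ind A) * ex μ 1 * ex μ (ind B) by rw [h1, mul_one],
      ex_mul_ex_mul_ex]
    exact sum_congr rfl fun ω _ => by simp
  rw [hT, ex_mul_ex_mul_ex, hD, hD, hD, mul_sum, ← sum_add_distrib, ← sum_add_distrib, ← sum_add_distrib,
    ← sum_sub_distrib]
  refine sum_congr rfl fun ω _ => ?_
  simp only [kernel3]
  ring

/-- **The degree-3 tensor-Bernstein expansion of `E₃`**: `E₃(μ_p; 1_U,1_V,1_W) = Σ_{j ≤ 3} combCoef3(j) · ∏_e p_e^{j_e}(1−p_e)^{3−j_e}`.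
[this work] -/
theorem sahiE_three_ind_bernstein (p : ι → unitInterval) (U V W : Set (Set ι)) :
    sahiE (bernoulliWeight p) 3 ![ind U, ind V, ind W] =
      ∑ j ∈ box (fun _ : ι => 3), combCoef3 U V W j * bern (fun _ => 3) j p := by
  rw [sahiE_three_ind_eq_sum_kernel3]
  have hmaps : ∀ ω ∈ (univ : Finset (Set ι × Set ι × Set ι)), prof3 ω ∈ box (fun _ : ι => 3) :=
    fun ω _ => prof3_mem_box ω
  rw [← sum_fiberwise_of_maps_to hmaps]
  refine sum_congr rfl fun j _ => ?_
  rw [combCoef3, sum_mul]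
  refine sum_congr rfl fun ω hω => ?_
  rw [weight3_eq_bern p ω, (mem_filter.1 hω).2]
  ring

/-- **Comb positivity of `E₃` from nonnegativity of the three-copy fibre sums.** [this work] -/
theorem combPos_sahiE_three_of_combCoef3_nonneg {U V W : Set (Set ι)} (h : ∀ j, 0 ≤ combCoef3 U V W j) :
    CombPos (fun _ : ι => 3) (fun p => sahiE (bernoulliWeight p) 3 ![ind U, ind V, ind W]) :=
  ⟨combCoef3 U V W, h, fun p => sahiE_three_ind_bernstein p U V W⟩


/-! ## The coefficient at a profile `j` is the twisted three-partition count of the `j`-sections -/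

/-- The ACTIVE coordinates of a profile `j`: those open in exactly one or exactly two of the three copies. [this work] -/
abbrev Act (j : ι → ℕ) : Type := {e : ι // j e = 1 ∨ j e = 2}

/-- Lift a set of active coordinates to a configuration on `ι`: plug in the inactive coordinates (open iff `j e = 3`). [this work] -/
def liftSet (j : ι → ℕ) (T : Set (Act j)) : Set ι := {e | j e = 3 ∨ ∃ h : j e = 1 ∨ j e = 2, (⟨e, h⟩ : Act j) ∈ T}

/-- The `j`-SECTION of a family `U ⊆ 2^ι`: the sets of active coordinates whose lift lies in `U`. [this work] -/
def secFam (j : ι → ℕ) (U : Set (Set ι)) : Set (Set (Act j)) := {T | liftSet j T ∈ U}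

/-- The twist of a profile: the active coordinates open in exactly TWO copies. [this work] -/
def twist (j : ι → ℕ) : Set (Act j) := {e | j e.1 = 2}

omit [Fintype ι] in
/-- Membership of an active coordinate in a lift. [this work] -/
theorem mem_liftSet_iff {j : ι → ℕ} {T : Set (Act j)} {e : ι} (h : j e = 1 ∨ j e = 2) :
    e ∈ liftSet j T ↔ (⟨e, h⟩ : Act j) ∈ T := by
  have h3 : j e ≠ 3 := by omega
  simp only [liftSet, Set.mem_setOf_eq, h3, false_or]
  exact ⟨fun ⟨_, hm⟩ => hm, fun hm => ⟨h, hm⟩⟩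

omit [Fintype ι] in
/-- Membership of an active coordinate (as a subtype element) in a lift. [this work] -/
theorem val_mem_liftSet_iff {j : ι → ℕ} {T : Set (Act j)} (e : Act j) : e.1 ∈ liftSet j T ↔ e ∈ T :=
  mem_liftSet_iff e.2

omit [Fintype ι] in
/-- Membership of an inactive coordinate in a lift. [this work] -/
theorem mem_liftSet_iff_of_not {j : ι → ℕ} {T : Set (Act j)} {e : ι} (h : ¬ (j e = 1 ∨ j e = 2)) :
    e ∈ liftSet j T ↔ j e = 3 := by
  simp only [liftSet, Set.mem_setOf_eq]
  exact ⟨fun h' => h'.elim id fun ⟨h'', _⟩ => absurd h'' h, fun h' => Or.inl h'⟩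

omit [Fintype ι] in
/-- Lifting is monotone. [this work] -/
theorem liftSet_mono (j : ι → ℕ) {T T' : Set (Act j)} (hT : T ⊆ T') : liftSet j T ⊆ liftSet j T' := by
  intro e he
  by_cases h : j e = 1 ∨ j e = 2
  · exact (mem_liftSet_iff h).2 (hT ((mem_liftSet_iff h).1 he))
  · exact (mem_liftSet_iff_of_not h).2 ((mem_liftSet_iff_of_not h).1 he)

omit [Fintype ι] in
/-- Sections of up-sets are up-sets. [this work] -/
theorem isUpperSet_secFam (j : ι → ℕ) {U : Set (Set ι)} (hU : IsUpperSet U) : IsUpperSet (secFam j U) :=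
  fun _ _ hTT' hT => hU (liftSet_mono j hTT') hT

omit [Fintype ι] in
/-- Sections commute with intersections. [this work] -/
theorem secFam_inter (j : ι → ℕ) (U V : Set (Set ι)) : secFam j (U ∩ V) = secFam j U ∩ secFam j V := rfl

/-- From an ordered 3-partition `(S₁, S₂, (S₁ ∪ S₂)ᶜ)` of the active coordinates to a triple of configurations with
profile `j`: copy `c` is the lift of `S_c ∆ twist`. [this work] -/
def toTriple (j : ι → ℕ) (q : Set (Act j) × Set (Act j)) : Set ι × Set ι × Set ι :=
  (liftSet j (q.1 ∆ twist j), liftSet j (q.2 ∆ twist j), liftSet j ((q.1 ∪ q.2)ᶜ ∆ twist j))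

/-- The inverse map: part `c` consists of the active coordinates whose ODD copy is `c`. [this work] -/
def toPair (j : ι → ℕ) (ω : Set ι × Set ι × Set ι) : Set (Act j) × Set (Act j) :=
  ({e | e.1 ∈ ω.1 ↔ j e.1 = 1}, {e | e.1 ∈ ω.2.1 ↔ j e.1 = 1})

omit [Fintype ι] in
/-- Unpacking `prof3 ω = j` at one coordinate. [this work] -/
theorem prof3_apply_eq {ω : Set ι × Set ι × Set ι} {j : ι → ℕ} (hω : prof3 ω = j) (e : ι) :
    (if e ∈ ω.1 then 1 else 0) + (if e ∈ ω.2.1 then 1 else 0) + (if e ∈ ω.2.2 then 1 else 0) = j e :=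
  congrFun hω e

omit [Fintype ι] in
/-- `toTriple` lands in the fibre of `j` (for `j ≤ 3`). [this work] -/
theorem prof3_toTriple {j : ι → ℕ} (hj : ∀ e, j e ≤ 3) {q : Set (Act j) × Set (Act j)} (hq : Disjoint q.1 q.2) :
    prof3 (toTriple j q) = j := by
  funext e
  simp only [prof3, toTriple]
  by_cases h : j e = 1 ∨ j e = 2
  · have hd : ¬ ((⟨e, h⟩ : Act j) ∈ q.1 ∧ (⟨e, h⟩ : Act j) ∈ q.2) :=
      fun hh => Set.disjoint_left.1 hq hh.1 hh.2
    simp only [mem_liftSet_iff h, Set.mem_symmDiff, twist, Set.mem_setOf_eq, Set.mem_compl_iff, Set.mem_union]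
    by_cases a1 : (⟨e, h⟩ : Act j) ∈ q.1 <;> by_cases a2 : (⟨e, h⟩ : Act j) ∈ q.2 <;>
      rcases h with h | h <;> simp_all
  · simp only [mem_liftSet_iff_of_not h]
    have := hj e
    by_cases h3 : j e = 3
    · simp [h3]
    · simp only [h3, if_false]; omega

omit [Fintype ι] in
/-- `toPair` of a fibre element is an ordered pair of DISJOINT parts. [this work] -/
theorem disjoint_toPair {j : ι → ℕ} {ω : Set ι × Set ι × Set ι} (hω : prof3 ω = j) :
    Disjoint (toPair j ω).1 (toPair j ω).2 := by
  rw [Set.disjoint_left]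
  intro e h1' h2'
  simp only [toPair, Set.mem_setOf_eq] at h1' h2'
  have hp := prof3_apply_eq hω e.1
  rcases e.2 with h | h <;>
    by_cases a : e.1 ∈ ω.1 <;> by_cases b : e.1 ∈ ω.2.1 <;> by_cases c : e.1 ∈ ω.2.2 <;> simp_all

omit [Fintype ι] in
/-- `toTriple ∘ toPair = id` on the fibre of `j`. [this work] -/
theorem toTriple_toPair {j : ι → ℕ} (hj : ∀ e, j e ≤ 3) {ω : Set ι × Set ι × Set ι} (hω : prof3 ω = j) :
    toTriple j (toPair j ω) = ω := by
  have key : ∀ e : ι, (e ∈ (toTriple j (toPair j ω)).1 ↔ e ∈ ω.1) ∧ (e ∈ (toTriple j (toPair j ω)).2.1 ↔ e ∈ ω.2.1) ∧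
      (e ∈ (toTriple j (toPair j ω)).2.2 ↔ e ∈ ω.2.2) := by
    intro e
    have hp := prof3_apply_eq hω e
    simp only [toTriple, toPair]
    by_cases h : j e = 1 ∨ j e = 2
    · simp only [mem_liftSet_iff h, Set.mem_symmDiff, twist, Set.mem_setOf_eq, Set.mem_compl_iff, Set.mem_union]
      rcases h with h | h <;>
        by_cases a : e ∈ ω.1 <;> by_cases b : e ∈ ω.2.1 <;> by_cases c : e ∈ ω.2.2 <;> simp_all
    · simp only [mem_liftSet_iff_of_not h]
      have h03 : j e = 0 ∨ j e = 3 := by have := hj e; omega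
      rcases h03 with h0 | h3 <;>
        by_cases a : e ∈ ω.1 <;> by_cases b : e ∈ ω.2.1 <;> by_cases c : e ∈ ω.2.2 <;> simp_all
  ext e
  · exact (key e).1
  · exact (key e).2.1
  · exact (key e).2.2

omit [Fintype ι] in
/-- `toPair ∘ toTriple = id` on ordered pairs. [this work] -/
theorem toPair_toTriple {j : ι → ℕ} (q : Set (Act j) × Set (Act j)) : toPair j (toTriple j q) = q := by
  have key : ∀ e : Act j, (e ∈ (toPair j (toTriple j q)).1 ↔ e ∈ q.1) ∧ (e ∈ (toPair j (toTriple j q)).2 ↔ e ∈ q.2) := by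
    intro e
    simp only [toPair, toTriple, Set.mem_setOf_eq, val_mem_liftSet_iff, Set.mem_symmDiff, twist]
    rcases e.2 with h | h <;> by_cases a1 : e ∈ q.1 <;> by_cases a2 : e ∈ q.2 <;> simp_all
  ext e
  · exact (key e).1
  · exact (key e).2

/-- **The fibre of `j` is parametrised by the ordered 3-partitions of the active coordinates**: the coefficient
`combCoef3(j)` is the sum of the kernel over `toTriple j` of the disjoint pairs. [this work] -/
theorem combCoef3_eq_sum_pairs (U V W : Set (Set ι)) {j : ι → ℕ} (hj : ∀ e, j e ≤ 3) :
    combCoef3 U V W j =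
      ∑ q ∈ (univ : Finset (Set (Act j) × Set (Act j))) with Disjoint q.1 q.2, kernel3 U V W (toTriple j q) := by
  unfold combCoef3
  refine sum_nbij' (toPair j) (toTriple j) (fun ω hω => ?_) (fun q hq => ?_) (fun ω hω => ?_) (fun q _ => ?_)
    (fun ω hω => ?_)
  · exact mem_filter.2 ⟨mem_univ _, disjoint_toPair (mem_filter.1 hω).2⟩
  · exact mem_filter.2 ⟨mem_univ _, prof3_toTriple hj (mem_filter.1 hq).2⟩
  · exact toTriple_toPair hj (mem_filter.1 hω).2
  · exact toPair_toTriple q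
  · rw [toTriple_toPair hj (mem_filter.1 hω).2]

/-- Profiles outside the box `j ≤ 3` have empty fibres: the coefficient vanishes. [this work] -/
theorem combCoef3_eq_zero_of_not_le (U V W : Set (Set ι)) {j : ι → ℕ} (hj : ¬ ∀ e, j e ≤ 3) :
    combCoef3 U V W j = 0 := by
  unfold combCoef3
  refine sum_eq_zero fun ω hω => ?_
  exfalso
  have h := (mem_filter.1 hω).2
  have hb := prof3_mem_box ω
  rw [h, mem_box] at hb
  exact hj hb

/-! ### Sums of indicator products over disjoint pairs are the twisted counts -/

/-- A twisted three-partition count as a sum of an indicator over the disjoint pairs. [this work] -/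
theorem triT_eq_sum_ite {α : Type*} [Fintype α] (τ : Set α) (P : Set α → Set α → Set α → Prop) :
    (triT τ P : ℝ) =
      ∑ q ∈ (univ : Finset (Set α × Set α)) with Disjoint q.1 q.2,
        if P (q.1 ∆ τ) (q.2 ∆ τ) ((q.1 ∪ q.2)ᶜ ∆ τ) then (1 : ℝ) else 0 := by
  rw [sum_filter]
  simp only [triT, tri]
  rw [natCast_card_filter]
  exact sum_congr rfl fun q _ => by
    by_cases hD : Disjoint q.1 q.2
    · rw [if_pos hD]
      by_cases hP : P (q.1 ∆ τ) (q.2 ∆ τ) ((q.1 ∪ q.2)ᶜ ∆ τ)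
      · rw [if_pos hP, if_pos ⟨hD, hP⟩]
      · rw [if_neg hP, if_neg fun h => hP h.2]
    · rw [if_neg hD, if_neg fun h => hD h.1]

omit [Fintype ι] in
/-- An indicator as an `if`. [folklore] -/
theorem ind_eq_ite' {α : Type*} (X : Set α) (x : α) : ind X x = if x ∈ X then 1 else 0 := by
  by_cases h : x ∈ X
  · rw [ind_of_mem h, if_pos h]
  · rw [ind_of_not_mem h, if_neg h]

omit [Fintype ι] in
/-- A product of two indicators as an `if`. [folklore] -/
theorem ind_mul2_ite {α β : Type*} (A : Set α) (B : Set β) (a : α) (b : β) :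
    ind A a * ind B b = if a ∈ A ∧ b ∈ B then 1 else 0 := by
  by_cases ha : a ∈ A <;> by_cases hb : b ∈ B <;> simp [ha, hb, ind_of_mem, ind_of_not_mem]

omit [Fintype ι] in
/-- A product of three indicators as an `if`. [folklore] -/
theorem ind_mul3_ite {α β γ : Type*} (A : Set α) (B : Set β) (C : Set γ) (a : α) (b : β) (c : γ) :
    ind A a * ind B b * ind C c = if a ∈ A ∧ b ∈ B ∧ c ∈ C then 1 else 0 := by
  by_cases ha : a ∈ A <;> by_cases hb : b ∈ B <;> by_cases hc : c ∈ C <;>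
    simp [ha, hb, hc, ind_of_mem, ind_of_not_mem]

omit [Fintype ι] in
/-- Indicators of lifts are indicators of sections. [this work] -/
theorem ind_liftSet (j : ι → ℕ) (U : Set (Set ι)) (T : Set (Act j)) : ind U (liftSet j T) = ind (secFam j U) T := by
  rw [ind_eq_ite', ind_eq_ite']; rfl

/-- **The tensor-Bernstein coefficient of `E₃` at a profile `j ≤ 3` IS the twisted three-partition functional of the
`j`-sections** (ground set = active coordinates of `j`, twist = coordinates open in two copies). [this work] -/
theorem combCoef3_eq_threePartNT (U V W : Set (Set ι)) {j : ι → ℕ} (hj : ∀ e, j e ≤ 3) :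
    combCoef3 U V W j = (threePartNT (twist j) (secFam j U) (secFam j V) (secFam j W) : ℝ) := by
  rw [combCoef3_eq_sum_pairs U V W hj]
  unfold threePartNT topT deeT teeT
  push_cast
  rw [triT_eq_sum_ite, triT_eq_sum_ite, triT_eq_sum_ite, triT_eq_sum_ite, triT_eq_sum_ite, mul_sum,
    ← sum_add_distrib, ← sum_add_distrib, ← sum_add_distrib, ← sum_sub_distrib]
  refine sum_congr rfl fun q _ => ?_
  simp only [kernel3, toTriple, ind_liftSet, secFam_inter]
  rw [ind_mul3_ite, ind_mul2_ite, ind_mul2_ite, ind_mul2_ite,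
    ind_eq_ite' (secFam j U ∩ secFam j V ∩ secFam j W)]
  split_ifs <;> norm_num

/-! ## The bridge -/

/-- **(★★) ⟹ (M⁺-3).**  Twisted three-partition positivity (`ThreePartitionPositivityTwisted`, this seat's conjecture, census-clean
for `m ≤ 4` exhaustively and `k ≤ 5` by ttrl2) implies comb (tensor-Bernstein) positivity of Sahi's `E₃` on every finite product
cube (`MasterFamilyCombPos 3`, cell prim-masterthm's (M⁺-3)). [this work] -/
theorem masterFamilyCombPos_three_of_threePartitionPositivityTwisted (h : ThreePartitionPositivityTwisted) :
    MasterFamilyCombPos 3 := by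
  intro ι _ U hU
  have hfun : (fun k => ind (U k)) = ![ind (U 0), ind (U 1), ind (U 2)] := by
    funext k; fin_cases k <;> rfl
  simp only [hfun]
  refine combPos_sahiE_three_of_combCoef3_nonneg fun j => ?_
  by_cases hj : ∀ e, j e ≤ 3
  · rw [combCoef3_eq_threePartNT (U 0) (U 1) (U 2) hj]
    exact_mod_cast h (Act j) (twist j) (secFam j (U 0)) (secFam j (U 1)) (secFam j (U 2))
      (isUpperSet_secFam j (hU 0)) (isUpperSet_secFam j (hU 1)) (isUpperSet_secFam j (hU 2))
  · rw [combCoef3_eq_zero_of_not_le (U 0) (U 1) (U 2) hj]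

/-- **(★★) ⟹ Sahi's `C₃` on product measures** (`MasterFamilyNonneg 3` = Kahn's Conjecture 5 by
`masterFamilyNonneg_three_iff_kahnConjecture`). [this work] -/
theorem masterFamilyNonneg_three_of_threePartitionPositivityTwisted (h : ThreePartitionPositivityTwisted) :
    MasterFamilyNonneg 3 :=
  masterFamilyCombPos_le_masterFamilyNonneg 3 (masterFamilyCombPos_three_of_threePartitionPositivityTwisted h)

end Summit.CriticalPhenomena.PercolationContinuityZ3.Theorems.ThreePartition
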